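import Mathlib
import Summits.Ventures.PercRepro2.A3FibreMain

/-!
# Fibres of the a₃-exploration that contain a mark: the `σ`/`U`-masses collapse to the world sign
(blind cell PercRepro2, night-1 g30; proofs/NIGHT1-G30.md §6)

On the fibre `Q ∩ {C(a₃) = W}` with a mark `x ∈ W`, the side of `x` is the side of `a₃`: `x ∈ C₁`
iff `a₁ ∈ W`, `x ∈ C₂` iff `a₂ ∈ W` (`fibre_inter_connEvent_of_mem`).  Hence the fibre masses of
`σ_x` and `U_x` are `s3 W · m_W` and `(s3 W)² · m_W` (`Ssig_eq_of_mem`, `Su_eq_of_mem`), and the mass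
of `F = σ_o + σ₃ (γ − U_o)` on a fibre containing `o` is `γ · s3 W · m_W` (`SF_eq_of_mem`).  The
masses of a null fibre vanish (`Ssig_eq_zero_of_mW_eq_zero`, `Su_eq_zero_of_mW_eq_zero`).  These
are the general facts behind the pendant classes of (MEANS-a₃) (`A3Between`), where every
non-null fibre other than `{a₃}` contains the attachment mark.  Standard axioms.
-/

namespace Summit.Ventures.PercRepro2

open UnionCluster

namespace CovForm

namespace A3Fibre

section Mark

variable {V : Type*} {E : Type*} [Fintype V] [DecidableEq V] [Fintype E] [DecidableEq E]

omit [Fintype V] [Fintype E] [DecidableEq E] in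
/-- On the fibre `W ∋ x`, the event `{x ∈ C(u)}` is all or nothing: it is the fibre if `u ∈ W`
and empty otherwise. -/
lemma fibre_inter_connEvent_of_mem (ends : E → Sym2 V) (a₁ a₂ a₃ u x : V) (W : Finset V)
    (hx : x ∈ W) :
    fibre ends a₁ a₂ a₃ W ∩ connEvent ends u x =
      if u ∈ W then fibre ends a₁ a₂ a₃ W else ∅ := by
  split_ifs with hu
  · ext ω
    simp only [fibre, Set.mem_inter_iff, mem_connEvent]
    constructor
    · rintro ⟨hf, _⟩; exact hf
    · intro hf
      have h3u : Conn ends ω a₃ u := (conn_a3_iff_mem hf.2).2 hu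
      have h3x : Conn ends ω a₃ x := (conn_a3_iff_mem hf.2).2 hx
      exact ⟨hf, conn_trans (conn_symm h3u) h3x⟩
  · ext ω
    simp only [fibre, Set.mem_inter_iff, mem_connEvent, Set.mem_empty_iff_false, iff_false,
      not_and]
    intro hf hc
    have h3x : Conn ends ω a₃ x := (conn_a3_iff_mem hf.2).2 hx
    exact hu ((conn_a3_iff_mem hf.2).1 (conn_trans h3x (conn_symm hc)))

variable {R : Type*} [CommRing R]

omit [Fintype V] [DecidableEq V] in
/-- With both roots in `W` the fibre mass vanishes. -/
lemma mW_eq_zero_of_mem_mem (p : E → R) (ends : E → Sym2 V) (a₁ a₂ a₃ : V) {W : Finset V}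
    (h₁ : a₁ ∈ W) (h₂ : a₂ ∈ W) : mW p ends a₁ a₂ a₃ W = 0 := by
  unfold mW
  rw [fibre_eq_empty_of_mem_mem ends a₁ a₂ a₃ h₁ h₂, prob_empty]

omit [Fintype V] in
/-- **The `σ`-mass of a mark in the fibre is the world sign times the mass**: for `x ∈ W`,
`Ssig_x W = s3 W · m_W`. -/
lemma Ssig_eq_of_mem (p : E → R) (ends : E → Sym2 V) (a₁ a₂ a₃ x : V) (W : Finset V)
    (hx : x ∈ W) :
    Ssig p ends a₁ a₂ a₃ x W = s3 a₁ a₂ W * mW p ends a₁ a₂ a₃ W := by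
  unfold Ssig s3 mW
  rw [fibre_inter_connEvent_of_mem ends a₁ a₂ a₃ a₁ x W hx,
    fibre_inter_connEvent_of_mem ends a₁ a₂ a₃ a₂ x W hx]
  by_cases h₁ : a₁ ∈ W <;> by_cases h₂ : a₂ ∈ W
  · rw [fibre_eq_empty_of_mem_mem ends a₁ a₂ a₃ h₁ h₂]
    simp [prob_empty]
  · simp [h₁, h₂, prob_empty]
  · simp [h₁, h₂, prob_empty]
  · simp [h₁, h₂, prob_empty]

omit [Fintype V] in
/-- **The `U`-mass of a mark in the fibre is `(s3 W)² · m_W`**: for `x ∈ W`,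
`Su_x W = (s3 W)^2 · m_W`. -/
lemma Su_eq_of_mem (p : E → R) (ends : E → Sym2 V) (a₁ a₂ a₃ x : V) (W : Finset V)
    (hx : x ∈ W) :
    Su p ends a₁ a₂ a₃ x W = s3 a₁ a₂ W ^ 2 * mW p ends a₁ a₂ a₃ W := by
  unfold Su s3 mW
  rw [fibre_inter_connEvent_of_mem ends a₁ a₂ a₃ a₁ x W hx,
    fibre_inter_connEvent_of_mem ends a₁ a₂ a₃ a₂ x W hx]
  by_cases h₁ : a₁ ∈ W <;> by_cases h₂ : a₂ ∈ W
  · rw [fibre_eq_empty_of_mem_mem ends a₁ a₂ a₃ h₁ h₂]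
    simp [prob_empty]
  · simp [h₁, h₂, prob_empty]
  · simp [h₁, h₂, prob_empty]
  · simp [h₁, h₂, prob_empty]

omit [Fintype V] in
/-- `s3 ∈ {0, ±1}`, so `s3³ = s3`. -/
lemma s3_pow_three (a₁ a₂ : V) (W : Finset V) : (s3 a₁ a₂ W : R) ^ 3 = s3 a₁ a₂ W := by
  unfold s3
  split_ifs <;> norm_num

end Mark

section MarkField

variable {V : Type*} {E : Type*} [Fintype V] [DecidableEq V] [Fintype E] [DecidableEq E]
  {R : Type*} [Field R] [LinearOrder R]

omit [Fintype V] [LinearOrder R] in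
/-- **The mass of `F` on a fibre containing `o` is `γ · s3 W · m_W`.** -/
lemma SF_eq_of_mem (p : E → R) (ends : E → Sym2 V) (o a₁ a₂ a₃ : V) (W : Finset V)
    (ho : o ∈ W) :
    SF p ends o a₁ a₂ a₃ W = gamma p ends o a₁ a₂ a₃ * s3 a₁ a₂ W * mW p ends a₁ a₂ a₃ W := by
  unfold SF
  rw [Ssig_eq_of_mem p ends a₁ a₂ a₃ o W ho, Su_eq_of_mem p ends a₁ a₂ a₃ o W ho]
  have h3 := s3_pow_three (R := R) a₁ a₂ W
  linear_combination (-(mW p ends a₁ a₂ a₃ W)) * h3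

omit [Fintype V] [DecidableEq V] in
/-- The `σ`-mass of a null fibre vanishes. -/
lemma Ssig_eq_zero_of_mW_eq_zero {p : E → R} [IsStrictOrderedRing R] (hp : IsProbVec p)
    (ends : E → Sym2 V) (a₁ a₂ a₃ x : V) (W : Finset V) (h : mW p ends a₁ a₂ a₃ W = 0) :
    Ssig p ends a₁ a₂ a₃ x W = 0 := by
  unfold Ssig
  unfold mW at h
  have h1 := prob_mono hp (Set.inter_subset_left : fibre ends a₁ a₂ a₃ W ∩ connEvent ends a₁ x ⊆ _)
  have h2 := prob_mono hp (Set.inter_subset_left : fibre ends a₁ a₂ a₃ W ∩ connEvent ends a₂ x ⊆ _)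
  have n1 := prob_nonneg hp (fibre ends a₁ a₂ a₃ W ∩ connEvent ends a₁ x)
  have n2 := prob_nonneg hp (fibre ends a₁ a₂ a₃ W ∩ connEvent ends a₂ x)
  rw [h] at h1 h2
  linarith

omit [Fintype V] [DecidableEq V] in
/-- The `U`-mass of a null fibre vanishes. -/
lemma Su_eq_zero_of_mW_eq_zero {p : E → R} [IsStrictOrderedRing R] (hp : IsProbVec p)
    (ends : E → Sym2 V) (a₁ a₂ a₃ x : V) (W : Finset V) (h : mW p ends a₁ a₂ a₃ W = 0) :
    Su p ends a₁ a₂ a₃ x W = 0 := by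
  unfold Su
  unfold mW at h
  have h1 := prob_mono hp (Set.inter_subset_left : fibre ends a₁ a₂ a₃ W ∩ connEvent ends a₁ x ⊆ _)
  have h2 := prob_mono hp (Set.inter_subset_left : fibre ends a₁ a₂ a₃ W ∩ connEvent ends a₂ x ⊆ _)
  have n1 := prob_nonneg hp (fibre ends a₁ a₂ a₃ W ∩ connEvent ends a₁ x)
  have n2 := prob_nonneg hp (fibre ends a₁ a₂ a₃ W ∩ connEvent ends a₂ x)
  rw [h] at h1 h2
  linarith

omit [Fintype V] in
/-- The mass of `F` on a null fibre vanishes. -/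
lemma SF_eq_zero_of_mW_eq_zero {p : E → R} [IsStrictOrderedRing R] (hp : IsProbVec p)
    (ends : E → Sym2 V) (o a₁ a₂ a₃ : V) (W : Finset V) (h : mW p ends a₁ a₂ a₃ W = 0) :
    SF p ends o a₁ a₂ a₃ W = 0 := by
  unfold SF
  rw [Ssig_eq_zero_of_mW_eq_zero hp ends a₁ a₂ a₃ o W h, Su_eq_zero_of_mW_eq_zero hp ends a₁ a₂ a₃ o W h, h]
  ring

end MarkField

end A3Fibre

end CovForm

end Summit.Ventures.PercRepro2
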